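import Summits.Ventures.Crystal3D.Theorems.StickyWulffConstantCoaxialWallLawReadingDirectionsCore
import Summits.Ventures.Crystal3D.Theorems.StickyWulffConstantCoaxialWallLawTailResidueDefs2
import Summits.Ventures.Crystal3D.Theorems.StickyWulffConstantCoaxialWallLawTwinReaderRigidity
import Summits.Ventures.Crystal3D.Theorems.StickyWulffConstantGenericWallFloorDozenRigidity
import Summits.Ventures.Crystal3D.Theorems.StickyWulffConstantGenericWallFloorCubicCoords
import HarnessLib

/-!
# Reading directions II: FINE CUBIC COORDINATES and the generalized frame lemma over `ℝ³`
# (crux `CoaxialWallLaw`, stmt-Ventures-19481, line `WallLedgerF`; T4 brick, census-free)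

HONEST FRAMING. Venture `Summits/Ventures/Crystal3D` (cell `crystal3d-full`); helper `--supports` the crux `CoaxialWallLaw`
(stmt-Ventures-19481, `route-Ventures-StickyWulffConstant`), REGISTERED line `WallLedgerF` (planner cf-p1, (xcv)(1): T4 pieces first).
Census-free; F-C1 not moved.  The real wrapper of `…ReadingDirectionsCore` (p695126):
* `fineVec t` — the vector with cubic coordinates `t/(9√2)`; `inner_fineVec` (`= dotI/162`), `fineVec_lin`; `modSite_eq_fineVec`
  (`modSite (i,n,k) = fineVec (9i+6n−6k, 9i+3n+6k, 3n+6k)`), `slotSite_eq_fineVec` (`= fineVec (9·slotInt k)`);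
* `cubicCoords_basalMirror` (`⅓[[1,2,2],[2,1,−2],[2,−2,1]]`), `basalMirror_fineVec`; `inclinedNormal_eq`, `norm_inclinedNormal`,
  `reflectAt_inclinedNormal_fineVec` (`R_c (fineVec t) = fineVec t − (dotI t M_c/54)·fineVec M_c`, `M_c = normFine c`);
* `stdIso j` — the eight standard placements `D₋, D₊, R₃D₋, R₀D₊, R₅D₋, R₂D₊, R₁D₊, R₄D₋` (order of `stdDozensInt`) as linear
  isometries; `stdIso_slotSite` (`stdIso j (slotSite k) = fineVec (dozen j k)`), `dozen_table` (bookkeeping vs `stdDozensInt`,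
  `decide`), `stdFrame_stdIso`;
* **`stdFrame_of_reading_triangle`** — THE GENERALIZED FRAME LEMMA: a linear isometry whose slot dozen contains three pairwise
  adjacent READING DIRECTIONS (`readingDirs = fineVec '' VInt ⊇` module bonds, `modSite_menu_mem_readingDirs`) is a `StdFrame`.
WHAT THIS IS NOT: not type soundness (`apexVecs ⊆ readingDirs` and the reader analysis come next); F-C1 not moved.
-/

noncomputable section

namespace Summit.Ventures.Crystal3D.Theorems

namespace TailResidue

open Summit.Ventures.Crystal3D Finset NearIdentity
open Literature.MathematicalPhysics.StatisticalMechanics (fccStacking basalMirror basalMirror_apply_coord triangularVec₁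
  barlowOffset layerNormal)
open scoped InnerProductSpace

/-! ### Fine cubic coordinates -/

/-- The vector with cubic coordinates `t/(9√2)`. -/
def fineVec (t : ℤ × ℤ × ℤ) : EuclideanSpace ℝ (Fin 3) :=
  ((t.1 : ℝ) / (9 * Real.sqrt 2)) • cubicFrame 0 + ((t.2.1 : ℝ) / (9 * Real.sqrt 2)) • cubicFrame 1 +
    ((t.2.2 : ℝ) / (9 * Real.sqrt 2)) • cubicFrame 2

/-- Cubic coordinates of `fineVec t`. -/
theorem cubicCoords_fineVec (t : ℤ × ℤ × ℤ) :
    cubicCoords (fineVec t) = ![(t.1 : ℝ) / (9 * Real.sqrt 2), (t.2.1 : ℝ) / (9 * Real.sqrt 2), (t.2.2 : ℝ) / (9 * Real.sqrt 2)] := by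
  simp only [fineVec, cubicCoords_add, cubicCoords_smul, cubicCoords_cubicFrame]
  ext i
  fin_cases i <;> simp

/-- `(9√2)² = 162`. -/
theorem nine_sqrt_two_sq : (9 * Real.sqrt 2) * (9 * Real.sqrt 2) = 162 := by
  have h2 : Real.sqrt 2 * Real.sqrt 2 = 2 := Real.mul_self_sqrt (by norm_num)
  linear_combination 81 * h2

/-- `0 < 9√2`. -/
theorem nine_sqrt_two_pos : 0 < 9 * Real.sqrt 2 := by positivity

/-- Inner products of fine vectors: `dotI / 162`. -/
theorem inner_fineVec (t u : ℤ × ℤ × ℤ) : ⟪fineVec t, fineVec u⟫_ℝ = (dotI t u : ℝ) / 162 := by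
  rw [inner_eq_cubicCoords, cubicCoords_fineVec, cubicCoords_fineVec, dotI]
  have h := nine_sqrt_two_sq
  have hp := nine_sqrt_two_pos
  simp only [dotProduct, Fin.sum_univ_three, Matrix.cons_val_zero, Matrix.cons_val_one, Matrix.cons_val_two,
    Matrix.head_cons, Matrix.tail_cons, div_mul_div_comm, h]
  push_cast
  ring

/-- Integer-linear combinations of fine vectors. -/
theorem fineVec_lin (t u : ℤ × ℤ × ℤ) (q : ℤ) :
    fineVec (t.1 + q * u.1, t.2.1 + q * u.2.1, t.2.2 + q * u.2.2) = fineVec t + (q : ℝ) • fineVec u := by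
  simp only [fineVec]
  push_cast
  module

/-- `fineVec` is determined by cubic coordinates: equality test on components. -/
theorem fineVec_eq_iff_of_cubicCoords {x : EuclideanSpace ℝ (Fin 3)} {u : ℤ × ℤ × ℤ}
    (h0 : cubicCoords x 0 = (u.1 : ℝ) / (9 * Real.sqrt 2)) (h1 : cubicCoords x 1 = (u.2.1 : ℝ) / (9 * Real.sqrt 2))
    (h2 : cubicCoords x 2 = (u.2.2 : ℝ) / (9 * Real.sqrt 2)) : x = fineVec u := by
  apply cubicCoords_injective
  rw [cubicCoords_fineVec]
  ext i
  fin_cases i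
  · simpa using h0
  · simpa using h1
  · simpa using h2

/-! ### Module sites and slots in fine coordinates -/

/-- Site coordinates `(i, n, k)` ↦ fine cubic coordinates. -/
def siteFine (s : ℤ × ℤ × ℤ) : ℤ × ℤ × ℤ :=
  (9 * s.1 + 6 * s.2.1 - 6 * s.2.2, 9 * s.1 + 3 * s.2.1 + 6 * s.2.2, 3 * s.2.1 + 6 * s.2.2)

/-- Cubic coordinates of the module generators. -/
theorem cubicCoords_generators :
    cubicCoords (triangularVec₁ 1) = ![1 / Real.sqrt 2, 1 / Real.sqrt 2, 0] ∧
    cubicCoords (barlowOffset 1) = ![2 / 3 / Real.sqrt 2, 1 / 3 / Real.sqrt 2, 1 / 3 / Real.sqrt 2] ∧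
    cubicCoords (layerNormal (Real.sqrt (2 / 3))) =
      ![-(2 / 3) / Real.sqrt 2, 2 / 3 / Real.sqrt 2, 2 / 3 / Real.sqrt 2] := by
  have h2 : Real.sqrt 2 ^ 2 = 2 := Real.sq_sqrt (by norm_num)
  have h3 : Real.sqrt 3 ^ 2 = 3 := Real.sq_sqrt (by norm_num)
  have h3' : Real.sqrt 3 ≠ 0 := by positivity
  have h2' : Real.sqrt 2 ≠ 0 := by positivity
  refine ⟨?_, ?_, ?_⟩ <;> ext i <;> fin_cases i <;>
    simp [cubicCoords, triangularVec₁, barlowOffset, layerNormal] <;> field_simp <;>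
    simp only [h2, h3] <;> ring

/-- **Module sites in fine coordinates.** -/
theorem modSite_eq_fineVec (s : ℤ × ℤ × ℤ) : modSite s = fineVec (siteFine s) := by
  obtain ⟨hT, hB, hL⟩ := cubicCoords_generators
  have hc : cubicCoords (modSite s) = (s.1 : ℝ) • cubicCoords (triangularVec₁ 1) +
      (s.2.1 : ℝ) • cubicCoords (barlowOffset 1) + (s.2.2 : ℝ) • cubicCoords (layerNormal (Real.sqrt (2 / 3))) := by
    simp only [modSite, cubicCoords_add, cubicCoords_smul]
  have hp := nine_sqrt_two_pos
  apply fineVec_eq_iff_of_cubicCoords <;> rw [hc, hT, hB, hL] <;> simp [siteFine] <;> field_simp <;> ring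

/-- The slot `k` in fine coordinates: `9 · slotInt k`. -/
def slotFine (k : Fin 12) : ℤ × ℤ × ℤ := (9 * slotInt k 0, 9 * slotInt k 1, 9 * slotInt k 2)

/-- **Slots in fine coordinates.** -/
theorem slotSite_eq_fineVec (k : Fin 12) : slotSite k = fineVec (slotFine k) := by
  have hp := nine_sqrt_two_pos
  have hs : (Real.sqrt 2) ≠ 0 := by positivity
  apply fineVec_eq_iff_of_cubicCoords <;> rw [cubicCoords_slotSite] <;> simp [slotVec, slotFine] <;> field_simp

/-! ### The basal mirror and the inclined mirrors in fine coordinates -/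

/-- The basal mirror in cubic coordinates: `⅓[[1,2,2],[2,1,−2],[2,−2,1]]`. -/
theorem cubicCoords_basalMirror (x : EuclideanSpace ℝ (Fin 3)) :
    cubicCoords (basalMirror x) =
      ![(cubicCoords x 0 + 2 * cubicCoords x 1 + 2 * cubicCoords x 2) / 3,
        (2 * cubicCoords x 0 + cubicCoords x 1 - 2 * cubicCoords x 2) / 3,
        (2 * cubicCoords x 0 - 2 * cubicCoords x 1 + cubicCoords x 2) / 3] := by
  ext i
  fin_cases i <;> simp [cubicCoords, basalMirror_apply_coord] <;> ring

/-- The integer form of the basal mirror (`× 3`). -/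
def bm3 (t : ℤ × ℤ × ℤ) : ℤ × ℤ × ℤ :=
  (t.1 + 2 * t.2.1 + 2 * t.2.2, 2 * t.1 + t.2.1 - 2 * t.2.2, 2 * t.1 - 2 * t.2.1 + t.2.2)

/-- **The basal mirror on fine vectors** (when the image is integral). -/
theorem basalMirror_fineVec {t u : ℤ × ℤ × ℤ} (h : bm3 t = (3 * u.1, 3 * u.2.1, 3 * u.2.2)) :
    basalMirror (fineVec t) = fineVec u := by
  simp only [bm3, Prod.mk.injEq] at h
  obtain ⟨h0, h1, h2⟩ := h
  have e0 : ((t.1 + 2 * t.2.1 + 2 * t.2.2 : ℤ) : ℝ) = 3 * u.1 := by exact_mod_cast h0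
  have e1 : ((2 * t.1 + t.2.1 - 2 * t.2.2 : ℤ) : ℝ) = 3 * u.2.1 := by exact_mod_cast h1
  have e2 : ((2 * t.1 - 2 * t.2.1 + t.2.2 : ℤ) : ℝ) = 3 * u.2.2 := by exact_mod_cast h2
  push_cast at e0 e1 e2
  have hp := nine_sqrt_two_pos
  apply fineVec_eq_iff_of_cubicCoords <;> rw [cubicCoords_basalMirror] <;> simp [cubicCoords_fineVec] <;>
    field_simp
  · linear_combination e0
  · linear_combination e1
  · linear_combination e2

/-- The inclined normals `× 3` in fine coordinates (`|M_c|² = 108`). -/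
def normFine : Fin 6 → ℤ × ℤ × ℤ := ![(6, 6, 6), (-6, -6, 6), (-6, 6, -6), (10, 2, 2), (-2, -10, 2), (-2, 2, -10)]

/-- Table: `siteFine (inclinedSum c) = 3 · normFine c` and `|normFine c|² = 108`. -/
theorem normFine_table : ∀ c : Fin 6, siteFine (inclinedSum c) =
    (3 * (normFine c).1, 3 * (normFine c).2.1, 3 * (normFine c).2.2) ∧ dotI (normFine c) (normFine c) = 108 := by
  decide

/-- The inclined normal is `fineVec (3·M_c)/√6`. -/
theorem inclinedNormal_eq (c : Fin 6) :
    inclinedNormal c = (Real.sqrt 6)⁻¹ • fineVec (3 * (normFine c).1, 3 * (normFine c).2.1, 3 * (normFine c).2.2) := by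
  rw [inclinedNormal, modSite_eq_fineVec, (normFine_table c).1]

/-- `fineVec (3·m) = 3 • fineVec m`. -/
theorem fineVec_three (m : ℤ × ℤ × ℤ) : fineVec (3 * m.1, 3 * m.2.1, 3 * m.2.2) = (3 : ℝ) • fineVec m := by
  simp only [fineVec]
  push_cast
  module

/-- **The inclined mirrors on fine vectors**: `R_c (fineVec t) = fineVec t − (dotI t M_c / 54) • fineVec M_c`. -/
theorem reflectAt_inclinedNormal_fineVec (c : Fin 6) (t : ℤ × ℤ × ℤ) :
    reflectAt (inclinedNormal c) 0 (fineVec t) = fineVec t - ((dotI t (normFine c) : ℝ) / 54) • fineVec (normFine c) := by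
  rw [reflectAt, sub_zero, inclinedNormal_eq, fineVec_three, inner_smul_right, inner_smul_right, inner_fineVec, smul_smul,
    smul_smul]
  have h6 : (Real.sqrt 6)⁻¹ * (Real.sqrt 6)⁻¹ = 6⁻¹ := by
    rw [← mul_inv, Real.mul_self_sqrt (by norm_num)]
  congr 2
  linear_combination ((dotI t (normFine c) : ℝ) / 9) * h6

/-- The integral form: if `dotI t M_c = 54 q` then `R_c (fineVec t) = fineVec (t − q·M_c)`. -/
theorem reflectAt_inclinedNormal_fineVec_of_dvd (c : Fin 6) (t : ℤ × ℤ × ℤ) (q : ℤ) (hq : dotI t (normFine c) = 54 * q) :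
    reflectAt (inclinedNormal c) 0 (fineVec t) =
      fineVec (t.1 + (-q) * (normFine c).1, t.2.1 + (-q) * (normFine c).2.1, t.2.2 + (-q) * (normFine c).2.2) := by
  rw [reflectAt_inclinedNormal_fineVec, fineVec_lin, hq]
  push_cast
  rw [show (54 : ℝ) * q / 54 = q by ring, sub_eq_add_neg, neg_smul]

/-! ### The eight standard placements as linear isometries -/

/-- Squared fine norms of the tripled normals. -/
theorem normFine_table₃ : ∀ c : Fin 6, dotI (3 * (normFine c).1, 3 * (normFine c).2.1, 3 * (normFine c).2.2)
    (3 * (normFine c).1, 3 * (normFine c).2.1, 3 * (normFine c).2.2) = 972 := by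
  decide

/-- The inclined normals are unit vectors. -/
theorem norm_inclinedNormal (c : Fin 6) : ‖inclinedNormal c‖ = 1 := by
  have h6 : (Real.sqrt 6)⁻¹ * (Real.sqrt 6)⁻¹ = 6⁻¹ := by
    rw [← mul_inv, Real.mul_self_sqrt (by norm_num)]
  have hsq : ‖inclinedNormal c‖ ^ 2 = 1 := by
    rw [← real_inner_self_eq_norm_sq, inclinedNormal_eq, real_inner_smul_left, real_inner_smul_right, inner_fineVec,
      normFine_table₃ c]
    push_cast
    linear_combination 6 * h6
  nlinarith [norm_nonneg (inclinedNormal c)]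

/-- The inclined mirror `c` as a linear isometry (Mathlib's reflection in `(ℝ ∙ n_c)ᗮ`). -/
def inclIso (c : Fin 6) : EuclideanSpace ℝ (Fin 3) ≃ₗᵢ[ℝ] EuclideanSpace ℝ (Fin 3) := (ℝ ∙ inclinedNormal c)ᗮ.reflection

/-- `inclIso c` is `reflectAt (inclinedNormal c) 0`. -/
theorem inclIso_apply (c : Fin 6) (x : EuclideanSpace ℝ (Fin 3)) : inclIso c x = reflectAt (inclinedNormal c) 0 x := by
  rw [inclIso, reflection_unit_apply (norm_inclinedNormal c), reflectAt, sub_zero]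

/-- `⇑(inclIso c) = reflectAt (inclinedNormal c) 0`. -/
theorem coe_inclIso (c : Fin 6) :
    (inclIso c : EuclideanSpace ℝ (Fin 3) → EuclideanSpace ℝ (Fin 3)) = reflectAt (inclinedNormal c) 0 :=
  funext (inclIso_apply c)

/-- **The eight standard placements** in the order of `stdDozensInt`:
`D₋, D₊, R₃D₋, R₀D₊, R₅D₋, R₂D₊, R₁D₊, R₄D₋`. -/
def stdIso (j : Fin 8) : EuclideanSpace ℝ (Fin 3) ≃ₗᵢ[ℝ] EuclideanSpace ℝ (Fin 3) :=
  match j with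
  | 0 => basalMirror
  | 1 => LinearIsometryEquiv.refl ℝ _
  | 2 => basalMirror.trans (inclIso 3)
  | 3 => inclIso 0
  | 4 => basalMirror.trans (inclIso 5)
  | 5 => inclIso 2
  | 6 => inclIso 1
  | 7 => basalMirror.trans (inclIso 4)

/-- The basal-twin slot `k` in fine coordinates (`⅓·bm3 (slotFine k)`). -/
def dMinusFine (k : Fin 12) : ℤ × ℤ × ℤ :=
  ((bm3 (slotFine k)).1 / 3, (bm3 (slotFine k)).2.1 / 3, (bm3 (slotFine k)).2.2 / 3)

/-- The integer form of the inclined mirror `c` (exact when `54 ∣ dotI t M_c`). -/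
def reflFine (c : Fin 6) (t : ℤ × ℤ × ℤ) : ℤ × ℤ × ℤ :=
  (t.1 + (-(dotI t (normFine c) / 54)) * (normFine c).1, t.2.1 + (-(dotI t (normFine c) / 54)) * (normFine c).2.1,
    t.2.2 + (-(dotI t (normFine c) / 54)) * (normFine c).2.2)

/-- The slot `k` of the standard placement `j` in fine coordinates. -/
def dozen (j : Fin 8) (k : Fin 12) : ℤ × ℤ × ℤ :=
  match j with
  | 0 => dMinusFine k
  | 1 => slotFine k
  | 2 => reflFine 3 (dMinusFine k)
  | 3 => reflFine 0 (slotFine k)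
  | 4 => reflFine 5 (dMinusFine k)
  | 5 => reflFine 2 (slotFine k)
  | 6 => reflFine 1 (slotFine k)
  | 7 => reflFine 4 (dMinusFine k)

/-- Divisibility bookkeeping (kernel `decide`): the basal twin slots are integral and every needed `dotI · M_c` is a multiple
of `54`. -/
theorem dozen_dvd_table :
    (∀ k : Fin 12, bm3 (slotFine k) = (3 * (dMinusFine k).1, 3 * (dMinusFine k).2.1, 3 * (dMinusFine k).2.2)) ∧
    (∀ c : Fin 6, c.val < 3 → ∀ k : Fin 12,
      dotI (slotFine k) (normFine c) = 54 * (dotI (slotFine k) (normFine c) / 54)) ∧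
    (∀ c : Fin 6, 3 ≤ c.val → ∀ k : Fin 12,
      dotI (dMinusFine k) (normFine c) = 54 * (dotI (dMinusFine k) (normFine c) / 54)) := by
  refine ⟨by decide, by decide, by decide⟩

/-- The j-th integer dozen of `…ReadingDirectionsCore`. -/
def dozenList (j : Fin 8) : List (ℤ × ℤ × ℤ) := stdDozensInt.getD j.val []

/-- Bookkeeping against `stdDozensInt` (kernel `decide`): every listed dozen is a `dozenList j`, and `dozenList j` is the
set of the twelve `dozen j k`. -/
theorem dozen_table :
    (∀ D ∈ stdDozensInt, ∃ j : Fin 8, D = dozenList j) ∧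
    (∀ j : Fin 8, ∀ t ∈ dozenList j, ∃ k : Fin 12, dozen j k = t) ∧ (∀ j : Fin 8, ∀ k : Fin 12, dozen j k ∈ dozenList j) := by
  refine ⟨by decide, by decide, by decide⟩

/-- The basal mirror of a slot. -/
theorem basalMirror_slotSite (k : Fin 12) : basalMirror (slotSite k) = fineVec (dMinusFine k) := by
  rw [slotSite_eq_fineVec]
  exact basalMirror_fineVec (dozen_dvd_table.1 k)

/-- An inclined mirror `c < 3` of a slot. -/
theorem inclIso_slotSite {c : Fin 6} (hc : c.val < 3) (k : Fin 12) :
    inclIso c (slotSite k) = fineVec (reflFine c (slotFine k)) := by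
  rw [inclIso_apply, slotSite_eq_fineVec,
    reflectAt_inclinedNormal_fineVec_of_dvd c _ _ (dozen_dvd_table.2.1 c hc k)]
  rfl

/-- An inclined mirror `c ≥ 3` of a basal-twin slot. -/
theorem inclIso_basalMirror_slotSite {c : Fin 6} (hc : 3 ≤ c.val) (k : Fin 12) :
    inclIso c (basalMirror (slotSite k)) = fineVec (reflFine c (dMinusFine k)) := by
  rw [inclIso_apply, basalMirror_slotSite,
    reflectAt_inclinedNormal_fineVec_of_dvd c _ _ (dozen_dvd_table.2.2 c hc k)]
  rfl

/-- **The slots of the standard placements in fine coordinates.** -/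
theorem stdIso_slotSite (j : Fin 8) (k : Fin 12) : stdIso j (slotSite k) = fineVec (dozen j k) := by
  fin_cases j
  · exact basalMirror_slotSite k
  · simp only [stdIso, dozen, LinearIsometryEquiv.coe_refl, id_eq]
    exact slotSite_eq_fineVec k
  · exact inclIso_basalMirror_slotSite (c := 3) (by decide) k
  · exact inclIso_slotSite (c := 0) (by decide) k
  · exact inclIso_basalMirror_slotSite (c := 5) (by decide) k
  · exact inclIso_slotSite (c := 2) (by decide) k
  · exact inclIso_slotSite (c := 1) (by decide) k
  · exact inclIso_basalMirror_slotSite (c := 4) (by decide) k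

/-- The fine dozens are slot dozens of the standard placements. -/
theorem fineVec_dozen_mem (j : Fin 8) (k : Fin 12) :
    fineVec (dozen j k) ∈ (stdIso j : EuclideanSpace ℝ (Fin 3) → EuclideanSpace ℝ (Fin 3)) '' ↑fccSlots :=
  ⟨slotSite k, by exact_mod_cast slotSite_mem k, stdIso_slotSite j k⟩

/-- **Every standard placement is a `StdFrame`.** -/
theorem stdFrame_stdIso (j : Fin 8) : StdFrame (stdIso j) := by
  fin_cases j
  · exact Or.inr (Or.inl rfl)
  · exact Or.inl (by simp [stdIso])
  · exact Or.inr (Or.inr (Or.inr ⟨3, by decide, by simp only [stdIso, LinearIsometryEquiv.coe_trans, Set.image_comp, coe_inclIso]⟩))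
  · exact Or.inr (Or.inr (Or.inl ⟨0, by decide, by simp only [stdIso, coe_inclIso]⟩))
  · exact Or.inr (Or.inr (Or.inr ⟨5, by decide, by simp only [stdIso, LinearIsometryEquiv.coe_trans, Set.image_comp, coe_inclIso]⟩))
  · exact Or.inr (Or.inr (Or.inl ⟨2, by decide, by simp only [stdIso, coe_inclIso]⟩))
  · exact Or.inr (Or.inr (Or.inl ⟨1, by decide, by simp only [stdIso, coe_inclIso]⟩))
  · exact Or.inr (Or.inr (Or.inr ⟨4, by decide, by simp only [stdIso, LinearIsometryEquiv.coe_trans, Set.image_comp, coe_inclIso]⟩))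

/-- `StdFrame` depends only on the slot dozen. -/
theorem stdFrame_of_image_eq {A B : EuclideanSpace ℝ (Fin 3) ≃ₗᵢ[ℝ] EuclideanSpace ℝ (Fin 3)}
    (h : (A : EuclideanSpace ℝ (Fin 3) → EuclideanSpace ℝ (Fin 3)) '' ↑fccSlots =
      (B : EuclideanSpace ℝ (Fin 3) → EuclideanSpace ℝ (Fin 3)) '' ↑fccSlots) (hB : StdFrame B) : StdFrame A := by
  unfold StdFrame at hB ⊢
  rw [h]
  exact hB

/-! ### The generalized frame lemma -/

/-- **THE READING DIRECTIONS** of a module window with first-generation apexes: the fine vectors of `VInt`. -/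
def readingDirs : Set (EuclideanSpace ℝ (Fin 3)) := {x | ∃ t ∈ VInt, fineVec t = x}

/-- Adjacency of reading directions is `dotI = 81`. -/
theorem dotI_eq_of_inner_eq_half {t u : ℤ × ℤ × ℤ} (h : ⟪fineVec t, fineVec u⟫_ℝ = 1 / 2) : dotI t u = 81 := by
  rw [inner_fineVec] at h
  have : (dotI t u : ℝ) = 81 := by linarith
  exact_mod_cast this

/-- **THE GENERALIZED FRAME LEMMA.**  If the slot dozen of a linear isometry `A` contains three pairwise adjacent READING
DIRECTIONS, then `A` is one of the `384` standard placements: its slot dozen is `D₊`, `D₋` or one of the six inclined twins. -/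
theorem stdFrame_of_reading_triangle (A : EuclideanSpace ℝ (Fin 3) ≃ₗᵢ[ℝ] EuclideanSpace ℝ (Fin 3))
    {a b c : EuclideanSpace ℝ (Fin 3)}
    (ha : a ∈ (A : EuclideanSpace ℝ (Fin 3) → EuclideanSpace ℝ (Fin 3)) '' ↑fccSlots)
    (hb : b ∈ (A : EuclideanSpace ℝ (Fin 3) → EuclideanSpace ℝ (Fin 3)) '' ↑fccSlots)
    (hc : c ∈ (A : EuclideanSpace ℝ (Fin 3) → EuclideanSpace ℝ (Fin 3)) '' ↑fccSlots)
    (hab : ⟪a, b⟫_ℝ = 1 / 2) (hac : ⟪a, c⟫_ℝ = 1 / 2) (hbc : ⟪b, c⟫_ℝ = 1 / 2)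
    (ra : a ∈ readingDirs) (rb : b ∈ readingDirs) (rc : c ∈ readingDirs) : StdFrame A := by
  obtain ⟨ta, hta, rfl⟩ := ra
  obtain ⟨tb, htb, rfl⟩ := rb
  obtain ⟨tc, htc, rfl⟩ := rc
  obtain ⟨D, hD, haD, hbD, hcD⟩ := triangle_in_stdDozen ta hta tb htb (dotI_eq_of_inner_eq_half hab) tc htc
    (dotI_eq_of_inner_eq_half hac) (dotI_eq_of_inner_eq_half hbc)
  obtain ⟨j, rfl⟩ := dozen_table.1 D hD
  obtain ⟨ka, hka⟩ := dozen_table.2.1 j ta haD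
  obtain ⟨kb, hkb⟩ := dozen_table.2.1 j tb hbD
  obtain ⟨kc, hkc⟩ := dozen_table.2.1 j tc hcD
  have ma := fineVec_dozen_mem j ka
  have mb := fineVec_dozen_mem j kb
  have mc := fineVec_dozen_mem j kc
  rw [hka] at ma; rw [hkb] at mb; rw [hkc] at mc
  have slot_fcc : ∀ (G : EuclideanSpace ℝ (Fin 3) ≃ₗᵢ[ℝ] EuclideanSpace ℝ (Fin 3)) {x : EuclideanSpace ℝ (Fin 3)},
      x ∈ (G : EuclideanSpace ℝ (Fin 3) → EuclideanSpace ℝ (Fin 3)) '' ↑fccSlots →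
        x ∈ G '' fccStacking 1 (Real.sqrt (2 / 3)) ∧ ‖x‖ = 1 := by
    intro G x hx
    obtain ⟨w, hw, rfl⟩ := hx
    rw [Finset.mem_coe] at hw
    exact ⟨⟨w, mem_fcc_of_mem_fccSlots hw, rfl⟩, by rw [LinearIsometryEquiv.norm_map, norm_eq_one_of_mem_fccSlots hw]⟩
  obtain ⟨fa, na⟩ := slot_fcc A ha
  obtain ⟨fb, nb⟩ := slot_fcc A hb
  obtain ⟨fc, nc⟩ := slot_fcc A hc
  have hind := linearIndependent_of_movedFcc_pairwise_half A fa fb fc na nb nc hab hac hbc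
  have hlat := movedFcc_eq_of_three_independent_units A (stdIso j) fa fb fc (slot_fcc _ ma).1 (slot_fcc _ mb).1
    (slot_fcc _ mc).1 na nb nc hind
  exact stdFrame_of_image_eq (image_fccSlots_eq_of_image_fcc_eq A (stdIso j) hlat) (stdFrame_stdIso j)

/-- Module bonds are reading directions: `modSite d ∈ readingDirs` for every menu offset `d`. -/
theorem modSite_menu_mem_readingDirs {d : ℤ × ℤ × ℤ} (hd : d ∈ menuOffsets) : modSite d ∈ readingDirs := by
  have tab : ∀ d ∈ menuOffsets, siteFine d ∈ VInt := by decide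
  exact ⟨siteFine d, tab d hd, (modSite_eq_fineVec d).symm⟩

/-- The slots of the standard placements are reading directions. -/
theorem stdIso_slotSite_mem_readingDirs (j : Fin 8) (k : Fin 12) : stdIso j (slotSite k) ∈ readingDirs :=
  have hmem : ∀ j : Fin 8, dozenList j ∈ stdDozensInt := by decide
  ⟨dozen j k, stdDozens_sub_VInt _ (hmem j) _ (dozen_table.2.2 j k), (stdIso_slotSite j k).symm⟩

end TailResidue

end Summit.Ventures.Crystal3D.Theorems

end
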